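import Summits.ResolutionOfSingularities.ResolutionOfSingularities.Theorems.HomologicalConductorSurfaceTerminationChartResolutionBirational
import Summits.ResolutionOfSingularities.ResolutionOfSingularities.Theorems.HomologicalConductorNoZenoExcCurvesLocalization
import HarnessLib

/-!
# Crux `NoZenoR` / `NoZeno` (stmt-ResolutionOfSingularities-19943 / -16483) — slot 5 (B1) closer, seam 1 piece (1α): THE CHART-GERM
# RESOLUTION PACKAGE — from a resolution factoring through the blow-up of an ideal, the resolution of the NEW GERM at a
# maximal ideal of the normalised chart ring, with its exceptional curves read off in the chart

Route `ResolutionOfSingularities/HomologicalConductor`, W4.4 chain, slot 5 `stub_L1wCoreF3`, closer skeleton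
`L/res-L0-w44-lead-1/L1wCoreCloser-SKELETON.lean` d2cae9e6707cd6ee step (2) «σ_B → chart resolution → germ resolution ψ := pullback.snd →
its curves» (res-L0-w44-plan-1 DESK WORD 15: `seam1_upstairs` → res-L0-w44-stub-3; this is sub-piece (1α) of the hand's DESIGN CENSUS
20:09:52Z).  A PURE BY-NAME COMPOSITION of three landed bricks, fixing their common currency once:

* `ChartResolution.exists_isResolution_chartMorphism` (U2a, `…SurfaceTerminationChartResolutionBirational`): for a resolution
  `ρ : Z → Spec T` (`T ⊆ K` normal, `Frac T = K`, function field identified with `K` by `e`), a morphism `σ_B : Z → Bl_I(Spec T)` over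
  `Spec T` and `0 ≠ x ∈ I`, the chart `V = σ_B⁻¹(D₊(xt))` is non-empty and carries a RESOLUTION `σ : V → Spec N` of the normalised chart
  ring `N = nrm k[T ∪ I·x⁻¹]`, over `Spec T`, with prescribed values of `σ^*`;
* `ChartResolution.isResolution_pullback_snd_of_isLocalization`: its base change `ψ := pullback.snd σ (Spec N_𝔮 → Spec N)` to a localisation
  is a resolution of `Spec N_𝔮`;
* `ExcCount.excCurvePoints_pullback_snd_localization` (res-L0-w44-lead-1 (A1), p555760): for `𝔮` MAXIMAL, the integral exceptional curves of
  `ψ` are, through `pullback.fst`, exactly the height-one points of `V` over `𝔮`.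

One theorem, `exists_chartGermResolution`, bundling the three conclusions for ANY `N'` with `[IsLocalization.AtPrime N' 𝔮]` (the
consumer's `D' = locPrime (nrm B) 𝔮 ⊆ K`).  Def-free, fact-free; `--supports 19943 --as helper`.  OURS (cell res-hironaka): AI-produced
and kernel-checked, weaker than expert review; nothing here is a statement of the manuscript under review (Hironaka 2017); counted 0.
-/

noncomputable section

-- single-problem summit: the doubled namespace component `ResolutionOfSingularities` is forced
set_option linter.dupNamespace false

open CategoryTheory CategoryTheory.Limits AlgebraicGeometry TopologicalSpace Opposite IsLocalRing
open Literature.AlgebraicGeometry.Resolution Literature.AlgebraicGeometry.Motives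
open Summit.ResolutionOfSingularities.ResolutionOfSingularities.Theorems.NoZeno.Birth
open Summit.ResolutionOfSingularities.ResolutionOfSingularities.Theorems.NoZeno.SandwichCluster
open Summit.ResolutionOfSingularities.ResolutionOfSingularities.Theorems.SurfaceTermination
open Summit.ResolutionOfSingularities.ResolutionOfSingularities.Theorems.SurfaceTermination.ChartResolution

namespace Summit.ResolutionOfSingularities.ResolutionOfSingularities.Theorems.NoZeno.ExcCount

variable {k K : Type} [Field k] [Field K] [Algebra k K]

/-- **THE CHART-GERM RESOLUTION PACKAGE (seam 1, piece (1α)).**  Let `ρ : Z → Spec T` be a resolution of the spectrum of a normal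
`k`-subalgebra `T ⊆ K` with `Frac T = K` (function field of `Z` identified with `K` by `e`, `he`), `σ_B : Z → Bl_I(Spec T)` a morphism
over `Spec T`, `0 ≠ x ∈ I`, `N := nrm k[T ∪ I·x⁻¹]` the normalised chart ring, `𝔮 ⊂ N` a MAXIMAL ideal and `N'` any localisation
of `N` at `𝔮` which is a domain.  Then: the chart `V = σ_B⁻¹(D₊(xt))` is non-empty and carries a resolution `σ : V → Spec N` over
`Spec T` with `e(σ^* y) = y` (U2a); its base change `ψ := pullback.snd σ (Spec N' → Spec N)` is a RESOLUTION of `Spec N'`; and the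
integral exceptional curves of `ψ` are, through `pullback.fst`, exactly the height-one points of `V` lying over `𝔮` ((A1)).
By-name composition of `ChartResolution.exists_isResolution_chartMorphism`, `ChartResolution.isResolution_pullback_snd_of_isLocalization`
and `excCurvePoints_pullback_snd_localization`. OURS. [folklore] -/
theorem exists_chartGermResolution (T : Subalgebra k K) [IsIntegrallyClosed ↥T] [IsFractionRing ↥T K]
    {Z : Scheme.{0}} [IsIntegral Z] (ρ : Z ⟶ Spec (.of ↥T))
    (e : ↑Z.functionField ≃+* K) (he : ∀ t : ↥T, e (baseToFunctionField ρ t) = (t : K))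
    {I : Ideal ↥T} (σB : Z ⟶ affineBlowup I) (hσB : σB ≫ affineBlowup.π I = ρ)
    {x : ↥T} (hxI : x ∈ I) (hρ : IsResolution ρ) (hx0 : (x : K) ≠ 0)
    (𝔮 : Ideal ↥(nrm (Algebra.adjoin k ((T : Set K) ∪ {y : K | ∃ c : ↥T, c ∈ I ∧ y = (c : K) * (x : K)⁻¹}))))
    [𝔮.IsMaximal] (N' : Type) [CommRing N'] [IsDomain N'] [IsLocalRing N']
    [Algebra ↥(nrm (Algebra.adjoin k ((T : Set K) ∪ {y : K | ∃ c : ↥T, c ∈ I ∧ y = (c : K) * (x : K)⁻¹}))) N']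
    [IsLocalization.AtPrime N' 𝔮] :
    ∃ (hne : ((σB ⁻¹ᵁ (affineBlowup.chartOpen x hxI).1 : Z.Opens) : Set Z).Nonempty)
      (σ : ((σB ⁻¹ᵁ (affineBlowup.chartOpen x hxI).1 : Z.Opens) : Scheme.{0}) ⟶
        Spec (.of ↥(nrm (Algebra.adjoin k ((T : Set K) ∪ {y : K | ∃ c : ↥T, c ∈ I ∧ y = (c : K) * (x : K)⁻¹}))))),
      (∀ y, e (Z.presheaf.germ _ (genericPoint Z)
          (genericPoint_mem_image_top (σB ⁻¹ᵁ (affineBlowup.chartOpen x hxI).1) hne)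
          (σ.appTop ((Scheme.ΓSpecIso (.of ↥(nrm (Algebra.adjoin k ((T : Set K) ∪
            {y : K | ∃ c : ↥T, c ∈ I ∧ y = (c : K) * (x : K)⁻¹}))))).inv y))) = (y : K)) ∧
      (σB ⁻¹ᵁ (affineBlowup.chartOpen x hxI).1).ι ≫ ρ =
        σ ≫ Spec.map (CommRingCat.ofHom
          (Subalgebra.inclusion (ChartResolution.le_nrm_adjoin T (I := I) (x := x))).toRingHom) ∧
      IsResolution σ ∧
      IsResolution (pullback.snd σ (Spec.map (CommRingCat.ofHom (algebraMap
        ↥(nrm (Algebra.adjoin k ((T : Set K) ∪ {y : K | ∃ c : ↥T, c ∈ I ∧ y = (c : K) * (x : K)⁻¹}))) N')))) ∧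
      excCurvePoints (pullback.snd σ (Spec.map (CommRingCat.ofHom (algebraMap
        ↥(nrm (Algebra.adjoin k ((T : Set K) ∪ {y : K | ∃ c : ↥T, c ∈ I ∧ y = (c : K) * (x : K)⁻¹}))) N')))) =
        (pullback.fst σ (Spec.map (CommRingCat.ofHom (algebraMap
          ↥(nrm (Algebra.adjoin k ((T : Set K) ∪ {y : K | ∃ c : ↥T, c ∈ I ∧ y = (c : K) * (x : K)⁻¹}))) N')))).base ⁻¹'
          {z | σ.base z = ⟨𝔮, Ideal.IsMaximal.isPrime inferInstance⟩ ∧ Order.height z = 1} := by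
  obtain ⟨hne, σ, hσv, hσc, hσres⟩ :=
    ChartResolution.exists_isResolution_chartMorphism T ρ e he σB hσB hxI hρ hx0
  haveI : IsDomain ↥(nrm (Algebra.adjoin k ((T : Set K) ∪ {y : K | ∃ c : ↥T, c ∈ I ∧ y = (c : K) * (x : K)⁻¹}))) :=
    inferInstance
  refine ⟨hne, σ, hσv, hσc, hσres, ?_, ?_⟩
  · exact ChartResolution.isResolution_pullback_snd_of_isLocalization 𝔮.primeCompl σ hσres
  · exact excCurvePoints_pullback_snd_localization 𝔮 σ

end Summit.ResolutionOfSingularities.ResolutionOfSingularities.Theorems.NoZeno.ExcCount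

end
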